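import Summits.SmoothPoincare4.SmoothPoincare4.Theses.EinsteinBulk
import Literature.Geometry.Riemannian.RiemannianDistance

/-!
# Piece X₂ `EinsteinBulk.YamabeNearRoundSpheresStandard` (item stmt-SmoothPoincare4-18032) — birth skeleton `qc-smoothing`
# (crux-strategist r1 of PEFillNearRound, 2026-08-17; plan adapted from crux idea `green-cross-ratio-rough-graham-lee` K1 + P1)

Yamabe-near-round homotopy 4-spheres are standard, through QUASICONFORMAL CLOSENESS instead of curvature:

* `stub_yamabePinchedQcRound` — for every `ε > 0` there is `δ > 0` such that a closed smooth homotopy 4-sphere carrying a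
  `δ`-near-round metric `g₀` (`Y(M,[g₀]) ≥ (1−δ)·8√6π`, the items' clause) admits a HOMEOMORPHISM `f : S⁴ → M` of metric
  dilatation `H_f ≤ 1 + ε` everywhere (Väisälä's metric definition, w.r.t. the chordal metric on `S⁴` and the Riemannian
  distance of `g₀`). Proposed mechanism: almost-sharp Sobolev ⇒ two-sided comparison of the conformal-Laplacian Green function
  with the round one (Green cross-ratio almost Möbius) ⇒ quantitative Kuiper. Open; NON-VACUOUS and falsifiable on `S⁴` itself.
* `stub_qcNearRoundSmoothable` — there is `ε > 0` such that a closed smooth Riemannian 4-manifold admitting a homeomorphism from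
  `S⁴` of metric dilatation `≤ 1 + ε` is DIFFEOMORPHIC to `S⁴` (Reshetnyak stability of `1`-quasiconformal maps in Liouville's
  theorem, §12 Thms 12.4–12.7, + mollification below the injectivity radii of both metrics; degree one). A theorem to write.

Composition `YamabeNearRoundSpheresStandard_of`: take `ε` from stub 2, `δ := δ(ε)` from stub 1 (pure logic).
Alternative line for the same piece (not typed here): Yamabe ⇒ Perelman-entropy comparison E + neck-tolerant entropy rung
(crux idea `yamabe-entropy-sheet-rung`).
-/

noncomputable section

set_option linter.dupNamespace false

open scoped Manifold ContDiff Topology ContinuousMap ENNReal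
open Set Filter
open Literature.Geometry.Lorentzian
open Summit.SmoothPoincare4.SmoothPoincare4.Theses

namespace Summit.SmoothPoincare4.SmoothPoincare4.Cruxes.YamabeNearRoundSpheresStandard.QcSmoothing

/-- Local notation for the model 4-sphere (chordal metric from `ℝ⁵`). -/
local notation "𝕊⁴" => (Metric.sphere (0 : EuclideanSpace ℝ (Fin 5)) 1)

section Defs

variable (M : Type) [TopologicalSpace M] [ChartedSpace (EuclideanSpace ℝ (Fin 4)) M] [IsManifold (𝓡 4) ∞ M]

/-- A `C^∞` Riemannian metric on the 4-manifold `M` (the items' metric type). -/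
abbrev Metric4 : Type :=
  Bundle.ContMDiffRiemannianMetric (𝓡 4) ∞ (EuclideanSpace ℝ (Fin 4)) (TangentSpace (𝓡 4) : M → Type _)

variable [T2Space M] [SecondCountableTopology M] [CompactSpace M] [MeasurableSpace M] [BorelSpace M]

/-- The items' inlined Yamabe clause `Y(M,[g₀]) ≥ (1−δ)·8√6π`. -/
def YamabeAtLeast (δ : ℝ) (g₀ : Metric4 M) : Prop :=
  ∀ (h' : Metric4 M) [(PseudoRiemannianMetric.ofRiemannian h').HasLeviCivita],
    (∃ φ : M → ℝ, ∀ x : M, 0 < φ x ∧ ∀ v w : TangentSpace (𝓡 4) x, h'.inner x v w = φ x * g₀.inner x v w) →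
      (1 - δ) * (8 * Real.sqrt 6 * Real.pi) * Real.sqrt ((riemannianMeasure h' Set.univ).toReal) ≤
        ∫ x, (PseudoRiemannianMetric.ofRiemannian h').scalarCurvature x ∂(riemannianMeasure h')

/-- Väisälä's METRIC DILATATION of a map `f : S⁴ → (M, d_{g₀})` at `x`:
`H_f(x) = limsup_{r → 0⁺} (sup_{|y−x|=r} d(f x, f y)) / (inf_{|y−x|=r} d(f x, f y))` (extended reals; chordal spheres on `S⁴`,
Riemannian distance `d_{g₀}` of `g₀` on `M`). A homeomorphism with `H_f ≤ K` everywhere is `K`-quasiconformal (metric definition). -/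
def metricDilatation (g₀ : Metric4 M) (f : 𝕊⁴ → M) (x : 𝕊⁴) : ℝ≥0∞ :=
  Filter.limsup
    (fun r : ℝ =>
      (⨆ y : {y : 𝕊⁴ // dist y x = r},
          (PseudoRiemannianMetric.ofRiemannian g₀).edist (PseudoRiemannianMetric.isRiemannian_ofRiemannian g₀) (f x) (f y)) /
        (⨅ y : {y : 𝕊⁴ // dist y x = r},
          (PseudoRiemannianMetric.ofRiemannian g₀).edist (PseudoRiemannianMetric.isRiemannian_ofRiemannian g₀) (f x) (f y)))
    (𝓝[>] (0 : ℝ))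

/-- `(M, g₀)` is `(1+ε)`-QUASICONFORMALLY ROUND: some homeomorphism `S⁴ ≃ₜ M` has metric dilatation `≤ 1 + ε` everywhere. -/
def QcRound (ε : ℝ) (g₀ : Metric4 M) : Prop :=
  ∃ f : 𝕊⁴ ≃ₜ M, ∀ x : 𝕊⁴, metricDilatation M g₀ f x ≤ ENNReal.ofReal (1 + ε)

end Defs

/-! ## The registered stubs -/

/-- **Stub 1 — YAMABE-PINCHED HOMOTOPY 4-SPHERES ARE QUASICONFORMALLY ROUND** (`Q_qc`): `∀ ε > 0 ∃ δ > 0`, a closed smooth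
`M ≃ₕ S⁴` with a `δ`-near-round metric is `(1+ε)`-quasiconformally round. Open (Green cross-ratio almost-Möbius ⇒ quantitative
Kuiper); non-vacuous on `S⁴` and falsifiable there (squashed / dumbbell classes). [cite: doi:10.4310/jdg/1214425634]
[cite: doi:10.5186/aasfm.1984.0914] [cite: Kobayashi1987] [cite: Schoen1989] -/
theorem stub_yamabePinchedQcRound :
    ∀ ε : ℝ, 0 < ε → ∃ δ : ℝ, 0 < δ ∧
      ∀ (M : Type) [TopologicalSpace M] [T2Space M] [SecondCountableTopology M] [ChartedSpace (EuclideanSpace ℝ (Fin 4)) M]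
        [IsManifold (𝓡 4) ∞ M] [CompactSpace M] [ConnectedSpace M] [MeasurableSpace M] [BorelSpace M],
        M ≃ₕ 𝕊⁴ → ∀ (g₀ : Metric4 M), YamabeAtLeast M δ g₀ → QcRound M ε g₀ := by
  sorry

/-- **Stub 2 — `(1+ε)`-QUASICONFORMALLY ROUND CLOSED SMOOTH 4-MANIFOLDS ARE DIFFEOMORPHIC TO `S⁴`** for some universal `ε > 0`
(Reshetnyak stability in Liouville's theorem + mollification; degree one). A theorem to write. [cite: doi:10.1090/mmono/073, §12.2]
[cite: zbl:0168.44301] -/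
theorem stub_qcNearRoundSmoothable :
    ∃ ε : ℝ, 0 < ε ∧
      ∀ (M : Type) [TopologicalSpace M] [T2Space M] [SecondCountableTopology M] [ChartedSpace (EuclideanSpace ℝ (Fin 4)) M]
        [IsManifold (𝓡 4) ∞ M] [CompactSpace M] [ConnectedSpace M] [MeasurableSpace M] [BorelSpace M]
        (g₀ : Metric4 M), QcRound M ε g₀ → Nonempty (M ≃ₘ⟮𝓡 4, 𝓡 4⟯ 𝕊⁴) := by
  sorry

/-! ## The composition: the piece BY NAME (pure logic; sorries only inside `stub_*`) -/

/-- From the two statements to `EinsteinBulk.YamabeNearRoundSpheresStandard`. -/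
theorem yamabeNearRoundSpheresStandard_of_qc
    (hQ : ∀ ε : ℝ, 0 < ε → ∃ δ : ℝ, 0 < δ ∧
      ∀ (M : Type) [TopologicalSpace M] [T2Space M] [SecondCountableTopology M] [ChartedSpace (EuclideanSpace ℝ (Fin 4)) M]
        [IsManifold (𝓡 4) ∞ M] [CompactSpace M] [ConnectedSpace M] [MeasurableSpace M] [BorelSpace M],
        M ≃ₕ 𝕊⁴ → ∀ (g₀ : Metric4 M), YamabeAtLeast M δ g₀ → QcRound M ε g₀)
    (hS : ∃ ε : ℝ, 0 < ε ∧
      ∀ (M : Type) [TopologicalSpace M] [T2Space M] [SecondCountableTopology M] [ChartedSpace (EuclideanSpace ℝ (Fin 4)) M]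
        [IsManifold (𝓡 4) ∞ M] [CompactSpace M] [ConnectedSpace M] [MeasurableSpace M] [BorelSpace M]
        (g₀ : Metric4 M), QcRound M ε g₀ → Nonempty (M ≃ₘ⟮𝓡 4, 𝓡 4⟯ 𝕊⁴)) :
    EinsteinBulk.YamabeNearRoundSpheresStandard := by
  obtain ⟨ε, hε, HS⟩ := hS
  obtain ⟨δ, hδ, HQ⟩ := hQ ε hε
  refine ⟨δ, hδ, ?_⟩
  intro M _ _ _ _ _ _ _ _ _ he g₀ hY
  exact HS M g₀ (HQ M he g₀ hY)

/-- **THE SKELETON THEOREM: `EinsteinBulk.YamabeNearRoundSpheresStandard` BY NAME from the two registered stubs.** -/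
theorem YamabeNearRoundSpheresStandard_of : EinsteinBulk.YamabeNearRoundSpheresStandard :=
  yamabeNearRoundSpheresStandard_of_qc stub_yamabePinchedQcRound stub_qcNearRoundSmoothable

/-! ## BC5 special case (no sorry): the piece holds on the model sphere itself, for any slack -/

/-- On `M = S⁴` the conclusion of the piece is witnessed by the identity diffeomorphism (the statement is inhabited in kind). -/
example (_g₀ : Metric4 𝕊⁴) : Nonempty (𝕊⁴ ≃ₘ⟮𝓡 4, 𝓡 4⟯ 𝕊⁴) :=
  ⟨Diffeomorph.refl (𝓡 4) 𝕊⁴ ∞⟩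

end Summit.SmoothPoincare4.SmoothPoincare4.Cruxes.YamabeNearRoundSpheresStandard.QcSmoothing

end
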